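import Summits.CriticalPhenomena.PercolationContinuityZ3.Theorems.Transplant.FKConnectivityAllQForestLastFreePair
import Summits.CriticalPhenomena.PercolationContinuityZ3.Theorems.Transplant.FKConnectivityAllQForestHubPairAbsorption
import Summits.CriticalPhenomena.PercolationContinuityZ3.Theorems.Transplant.FKConnectivityAllQForestHubPairOneClassIdentities
import HarnessLib

/-!
# THE DESCENT of the absorption architecture: one-class hub-pair positivity (★) from absorption monotonicity (AAM) and the node of
# smaller fibres

Support file (`--supports stmt-CriticalPhenomena-4575`), FK sub-lane `prim-bschramm-fk-1` (gen 26) of the post-continuity programme;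
builds on p205010 (kernel theorem, internal audit signed; external expert review pending).  No definitions, no named facts, no sorries;
standard axioms.  Part 1 of 2 of the assembly "M4" of memo bschramm/FROM-fk-1-g25-HUB-PAIR-DECOMPOSITION.md §6c/§6f (part 2:
`…ForestAbsorptionArrow`, the arrow `HubPairAbsorptionMonoOn V → AdjForestRayleighNoSqOn V`).

Setting: fibre `(N, u)`, hub `o`, `e = ov`, `f = oy`, a vertex `a`; `[x]` = pinned class; (★) at `(o, a)` is `sRR + sBB ≤ dRB + dBR` for the four
type-A counts (`a` reachable from `o` in the first class, not in the second).  AAM = the typed node `HubPairAbsorptionMonoOn` (g25, NOT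
asserted).
* tools: `pinned_subset_and_partner`, `fibreCount_forest_eq_zero_of_quotLoop` (a free pair inside one pinned class empties the fibre),
  `reachable_of_reachable_insert_pinned` (pinning a far pair does not join far classes), `typeA_count_congr_of_pinned` (move the type vertex
  inside its class), `setOf_reachable_eq_reachEv` / `setOf_not_reachable_eq_compl` (the two spellings of the type events), `hubPairOneClass_symm`
  (`v ↔ y`), `hubPairOneClass_le_of_pinned_to_v` ((★), with equality, at a vertex pinned to `v`: F3), `typeA_count_eq_zero_of_no_pair` (no free
  pair at `[a]` ⇒ the type-A counts vanish, by `exists_last_free_pair`);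
* **`hubPairOneClass_of_absorption_step`** — ONE ABSORPTION: AAM at a free pair `s(a₁, x)` from `[a]` to a vertex `x ∉ {o,v,y}` reduces (★) at
  `(o,a)` on `(N,u)` to (★) at `(o,a₁)` on `(N ∖ s(a₁,x), u ∪ {s(a₁,x)})`;
* **`hubPairOneClass_of_insert_node`** — THE "INSERT `oa`" STEP (F5c): if `[a] ∉ {[o],[v],[y]}`, `s(o,a)` is not in the fibre and a free pair joins
  `[a]` to `[v]` or `[y]`, then (★) at `(o,a)` on `(N,u)` follows from the node on `(N ∪ {s(o,a)}, u)` — by F1 the node's margin there is twice the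
  pinned margin, which VANISHES by F6 (the `[a]–[v]` pair becomes parallel to `e`), plus the one-class sum;
* **`hubPairOneClass_descent`** — THE DESCENT: given AAM and the node on all fibres with fewer than `k` free pairs, (★) holds at `(o,a)` on every
  fibre with at most `k − 2` free pairs and `[a], [o], [v], [y]` pairwise distinct: a pair `[o]–[a]` is F2 + node; a pair to a fresh class is
  one absorption + the descent one level down; no pair at `[a]` gives `0`; otherwise the insert-`oa` step.
[cite: SempleWelsh2008, Conj. 1.1 (p. 2); Thm. 4.2 (p. 11)] [cite: Linusson2011, Prop. 2.6] [cite: Grimmett2006, §1.5 (p. 13)]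
-/

noncomputable section

namespace Summit.CriticalPhenomena.PercolationContinuityZ3.Theorems
namespace FK

open Set Literature.Probability.LatticeModels Literature.Probability.Percolation
open scoped Classical symmDiff

variable {V : Type*} [Fintype V]

/-! ### Tools -/

section Tools

variable {M u₀ : BondConfig V} {o v y a : V}

omit [Fintype V] in
/-- The pinned pairs lie in every configuration of the fibre and in every partner. [folklore] -/
theorem pinned_subset_and_partner (hd : Disjoint u₀ M) {ω : BondConfig V} (hω : ω \ M = u₀) : u₀ ⊆ ω ∧ u₀ ⊆ ω ∆ M := by
  have hsub : u₀ ⊆ ω := fun r hr => (show r ∈ ω \ M by rw [hω]; exact hr).1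
  exact ⟨hsub, fun r hr => Set.mem_symmDiff.2 (Or.inl ⟨hsub hr, fun hrM => hd.le_bot ⟨hr, hrM⟩⟩)⟩

/-- **A quotient loop empties the fibre**: a free pair joining two vertices of one pinned class lies in no forest class containing the pinned
pairs, so every forest fibre count vanishes. [cite: Grimmett2006, §1.5 (p. 13)] [cite: Linusson2011, Prop. 2.6] -/
theorem fibreCount_forest_eq_zero_of_quotLoop (hd : Disjoint u₀ M) {z w : V} (hpM : s(z, w) ∈ M)
    (hloop : (openGraph u₀).Reachable z w) (P Q : Set (BondConfig V)) :
    fibreCount M u₀ (forestEv V ∩ P) (forestEv V ∩ Q) = 0 := by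
  have hpu : s(z, w) ∉ u₀ := fun h => hd.le_bot ⟨h, hpM⟩
  have key : ∀ β : BondConfig V, u₀ ⊆ β → IsForestCfg β → s(z, w) ∉ β := by
    intro β hsub hF hp
    by_cases hzw : z = w
    · exact hF.1 _ hp (Sym2.mk_isDiag_iff.2 hzw)
    have hsub' : u₀ ⊆ β \ {s(z, w)} := fun r hr => ⟨hsub hr, fun h => hpu ((mem_singleton_iff.1 h) ▸ hr)⟩
    have hback : insert s(z, w) (β \ {s(z, w)}) = β := by rw [insert_sdiff_singleton, insert_eq_of_mem hp]
    have hF' : IsForestCfg (insert s(z, w) (β \ {s(z, w)})) := by rw [hback]; exact hF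
    exact ((isForestCfg_insert_iff hzw (fun h => h.2 rfl)).1 hF').2 (hloop.mono (openGraph_mono hsub'))
  refine fibreCount_eq_zero_of_forall _ _ _ _ fun ω hω hA hB => ?_
  obtain ⟨hsub, hsub'⟩ := pinned_subset_and_partner hd hω
  by_cases hp : s(z, w) ∈ ω
  · exact key ω hsub hA.1 hp
  · exact key (ω ∆ M) hsub' hB.1 (Set.mem_symmDiff.2 (Or.inr ⟨hpM, hp⟩))

omit [Fintype V] in
/-- **Pinning a pair does not join far classes**: if neither endpoint of `s(x, w)` is `u`-reachable from `s`, reachability from `s` in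
`u ∪ {s(x,w)}` is reachability in `u`. [folklore] -/
theorem reachable_of_reachable_insert_pinned {u : BondConfig V} {s t x w : V} (h : (openGraph (insert s(x, w) u)).Reachable s t)
    (hx : ¬ (openGraph u).Reachable s x) (hw : ¬ (openGraph u).Reachable s w) : (openGraph u).Reachable s t := by
  by_contra hst
  obtain ⟨W⟩ := h
  have hsS : s ∈ {z | (openGraph u).Reachable s z} := SimpleGraph.Reachable.refl _
  obtain ⟨d, -, hd1, hd2⟩ := W.exists_boundary_dart {z | (openGraph u).Reachable s z} hsS hst
  simp only [mem_setOf_eq] at hd1 hd2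
  have hadj := (openGraph_adj (insert s(x, w) u) d.fst d.snd).1 d.adj
  rcases mem_insert_iff.1 hadj.1 with hdg | hdu
  · rcases Sym2.eq_iff.1 hdg with ⟨h1, -⟩ | ⟨h1, -⟩
    · exact hx (h1 ▸ hd1)
    · exact hw (h1 ▸ hd1)
  · exact hd2 (hd1.trans ((openGraph_adj u d.fst d.snd).2 ⟨hdu, hadj.2⟩).reachable)

/-- **The type vertex may be moved inside its pinned class**: the type-A counts at `(o, a)` and at `(o, a₁)` agree when `a ~ a₁` is pinned.
[cite: Linusson2011, Prop. 2.6] -/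
theorem typeA_count_congr_of_pinned (hd : Disjoint u₀ M) {a₁ : V} (ha : (openGraph u₀).Reachable a a₁) (P Q : Set (BondConfig V)) :
    fibreCount M u₀ (P ∩ {ω | (openGraph ω).Reachable o a}) (Q ∩ {ω | ¬ (openGraph ω).Reachable o a}) =
      fibreCount M u₀ (P ∩ {ω | (openGraph ω).Reachable o a₁}) (Q ∩ {ω | ¬ (openGraph ω).Reachable o a₁}) := by
  refine fibreCount_congr_fibre M u₀ fun ω hω => ?_
  obtain ⟨h1, h2⟩ := pinned_subset_and_partner hd hω
  have e1 : (openGraph ω).Reachable o a ↔ (openGraph ω).Reachable o a₁ :=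
    ⟨fun h => h.trans (ha.mono (openGraph_mono h1)), fun h => h.trans (ha.mono (openGraph_mono h1)).symm⟩
  have e2 : (openGraph (ω ∆ M)).Reachable o a ↔ (openGraph (ω ∆ M)).Reachable o a₁ :=
    ⟨fun h => h.trans (ha.mono (openGraph_mono h2)), fun h => h.trans (ha.mono (openGraph_mono h2)).symm⟩
  simp only [mem_inter_iff, mem_setOf_eq, e1, e2]

end Tools

/-! ### One absorption step (AAM) and the "insert `oa`" step (F1 + F6 + node) -/

section Steps

variable {N u : BondConfig V} {o v y a : V}

/-- **One absorption step.**  If `q = s(a₁, x)` is a free pair from the pinned class of `a` to a vertex `x ∉ {o, v, y}` (literally), and (★)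
holds at `(o, a₁)` on the fibre with `q` pinned, then (★) holds at `(o, a)` on `(N, u)` — by AAM `HubPairAbsorptionMonoOn`.
[cite: SempleWelsh2008, Conj. 1.1 (p. 2)] [cite: Linusson2011, Prop. 2.6] -/
theorem hubPairOneClass_of_absorption_step (hA : HubPairAbsorptionMonoOn V) (hd : Disjoint u N) (hvy : v ≠ y) {a₁ x : V}
    (hqN : s(a₁, x) ∈ N) (ha₁ : (openGraph u).Reachable a a₁) (hxo : x ≠ o) (hxv : x ≠ v) (hxy : x ≠ y)
    (hqe : s(a₁, x) ≠ s(o, v)) (hqf : s(a₁, x) ≠ s(o, y))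
    (hrec : fibreCount (N \ {s(a₁, x)}) (insert s(a₁, x) u)
          (forestEv V ∩ {ω | s(o, v) ∈ ω ∧ s(o, y) ∈ ω} ∩ {ω | (openGraph ω).Reachable o a₁}) (forestEv V ∩ {ω | ¬ (openGraph ω).Reachable o a₁}) +
        fibreCount (N \ {s(a₁, x)}) (insert s(a₁, x) u)
          (forestEv V ∩ {ω | (openGraph ω).Reachable o a₁}) (forestEv V ∩ {ω | s(o, v) ∈ ω ∧ s(o, y) ∈ ω} ∩ {ω | ¬ (openGraph ω).Reachable o a₁}) ≤
      fibreCount (N \ {s(a₁, x)}) (insert s(a₁, x) u)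
          (forestEv V ∩ {ω | s(o, v) ∈ ω} ∩ {ω | (openGraph ω).Reachable o a₁}) (forestEv V ∩ {ω | s(o, y) ∈ ω} ∩ {ω | ¬ (openGraph ω).Reachable o a₁}) +
        fibreCount (N \ {s(a₁, x)}) (insert s(a₁, x) u)
          (forestEv V ∩ {ω | s(o, y) ∈ ω} ∩ {ω | (openGraph ω).Reachable o a₁}) (forestEv V ∩ {ω | s(o, v) ∈ ω} ∩ {ω | ¬ (openGraph ω).Reachable o a₁})) :
    fibreCount N u (forestEv V ∩ {ω | s(o, v) ∈ ω ∧ s(o, y) ∈ ω} ∩ {ω | (openGraph ω).Reachable o a}) (forestEv V ∩ {ω | ¬ (openGraph ω).Reachable o a}) +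
        fibreCount N u (forestEv V ∩ {ω | (openGraph ω).Reachable o a}) (forestEv V ∩ {ω | s(o, v) ∈ ω ∧ s(o, y) ∈ ω} ∩ {ω | ¬ (openGraph ω).Reachable o a}) ≤
      fibreCount N u (forestEv V ∩ {ω | s(o, v) ∈ ω} ∩ {ω | (openGraph ω).Reachable o a}) (forestEv V ∩ {ω | s(o, y) ∈ ω} ∩ {ω | ¬ (openGraph ω).Reachable o a}) +
        fibreCount N u (forestEv V ∩ {ω | s(o, y) ∈ ω} ∩ {ω | (openGraph ω).Reachable o a}) (forestEv V ∩ {ω | s(o, v) ∈ ω} ∩ {ω | ¬ (openGraph ω).Reachable o a}) := by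
  have key := hA N u hd o v y a₁ x hvy hxo hxv hxy hqN hqe hqf
  rw [typeA_count_congr_of_pinned hd ha₁ (forestEv V ∩ {ω | s(o, v) ∈ ω ∧ s(o, y) ∈ ω}) (forestEv V),
    typeA_count_congr_of_pinned hd ha₁ (forestEv V) (forestEv V ∩ {ω | s(o, v) ∈ ω ∧ s(o, y) ∈ ω}),
    typeA_count_congr_of_pinned hd ha₁ (forestEv V ∩ {ω | s(o, v) ∈ ω}) (forestEv V ∩ {ω | s(o, y) ∈ ω}),
    typeA_count_congr_of_pinned hd ha₁ (forestEv V ∩ {ω | s(o, y) ∈ ω}) (forestEv V ∩ {ω | s(o, v) ∈ ω})]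
  omega

/-- **The "insert `oa`" step (F5c).**  If `[a] ∉ {[o],[v],[y]}`, `s(o,a)` is not a pair of the fibre, some free pair joins `[a]` to `[v]` or to
`[y]`, and the node holds on `(N ∪ {s(o,a)}, u)`, then (★) holds at `(o, a)` on `(N, u)`: by F1 the node's margin there is twice the pinned margin
(zero by F6) plus the one-class sum. [cite: SempleWelsh2008, Conj. 1.1 (p. 2)] [cite: Linusson2011, Prop. 2.6] -/
theorem hubPairOneClass_of_insert_node (hd : Disjoint u N) (hvy : v ≠ y) (heN : s(o, v) ∈ N) (hfN : s(o, y) ∈ N)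
    (hao : ¬ (openGraph u).Reachable a o) (hav : ¬ (openGraph u).Reachable a v) (hay : ¬ (openGraph u).Reachable a y)
    (hov : ¬ (openGraph u).Reachable o v) (hoy : ¬ (openGraph u).Reachable o y) (hoaN : s(o, a) ∉ N)
    {a₂ t : V} (hgN : s(a₂, t) ∈ N) (ha₂ : (openGraph u).Reachable a a₂) (ht : (openGraph u).Reachable v t ∨ (openGraph u).Reachable y t)
    (hnode : fibreCount (insert s(o, a) N) u (forestEv V ∩ {ω | s(o, v) ∈ ω ∧ s(o, y) ∈ ω}) (forestEv V) ≤
      fibreCount (insert s(o, a) N) u (forestEv V ∩ {ω | s(o, v) ∈ ω}) (forestEv V ∩ {ω | s(o, y) ∈ ω})) :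
    fibreCount N u (forestEv V ∩ {ω | s(o, v) ∈ ω ∧ s(o, y) ∈ ω} ∩ reachEv o a) (forestEv V ∩ (reachEv o a)ᶜ) +
        fibreCount N u (forestEv V ∩ reachEv o a) (forestEv V ∩ {ω | s(o, v) ∈ ω ∧ s(o, y) ∈ ω} ∩ (reachEv o a)ᶜ) ≤
      fibreCount N u (forestEv V ∩ {ω | s(o, v) ∈ ω} ∩ reachEv o a) (forestEv V ∩ {ω | s(o, y) ∈ ω} ∩ (reachEv o a)ᶜ) +
        fibreCount N u (forestEv V ∩ {ω | s(o, y) ∈ ω} ∩ reachEv o a) (forestEv V ∩ {ω | s(o, v) ∈ ω} ∩ (reachEv o a)ᶜ) := by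
  have hoa : o ≠ a := fun h => hao (h ▸ SimpleGraph.Reachable.refl _)
  have hoau : s(o, a) ∉ u := fun h => hao ((openGraph_adj u a o).2 ⟨Sym2.eq_swap ▸ h, hoa.symm⟩).reachable
  have hge : s(o, a) ≠ s(o, v) := by
    intro h'; rcases Sym2.eq_iff.1 h' with ⟨-, h2⟩ | ⟨h1, -⟩
    · exact hav (h2 ▸ SimpleGraph.Reachable.refl _)
    · exact hov (h1 ▸ SimpleGraph.Reachable.refl _)
  have hgf : s(o, a) ≠ s(o, y) := by
    intro h'; rcases Sym2.eq_iff.1 h' with ⟨-, h2⟩ | ⟨h1, -⟩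
    · exact hay (h2 ▸ SimpleGraph.Reachable.refl _)
    · exact hoy (h1 ▸ SimpleGraph.Reachable.refl _)
  have hb := adjForestNoSq_bad_split (u := u) (e := s(o, v)) (f := s(o, y)) hoa hoaN hoau hge hgf
  have hg := adjForestNoSq_good_split (u := u) (e := s(o, v)) (f := s(o, y)) hoa hoaN hoau hge hgf
  -- the pinned fibre `(N, u + oa)`: `[a] = [o]`, so the pair `s(a₂, t)` is parallel to `e` or to `f`: bad = good (F6)
  have hd' : Disjoint (insert s(o, a) u) N := Set.disjoint_insert_left.2 ⟨hoaN, hd⟩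
  have ho₂ : (openGraph (insert s(o, a) u)).Reachable o a₂ :=
    ((openGraph_adj _ o a).2 ⟨mem_insert _ _, hoa⟩).reachable.trans (ha₂.mono (openGraph_mono (subset_insert _ _)))
  have hov' : o ≠ v := fun h => hov (h ▸ SimpleGraph.Reachable.refl _)
  have hoy' : o ≠ y := fun h => hoy (h ▸ SimpleGraph.Reachable.refl _)
  have ha₂t : a₂ ≠ t := by
    rintro rfl
    rcases ht with ht | ht
    · exact hav (ha₂.trans ht.symm)
    · exact hay (ha₂.trans ht.symm)
  have hpin : fibreCount N (insert s(o, a) u) (forestEv V ∩ {ω | s(o, v) ∈ ω ∧ s(o, y) ∈ ω}) (forestEv V) =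
      fibreCount N (insert s(o, a) u) (forestEv V ∩ {ω | s(o, v) ∈ ω}) (forestEv V ∩ {ω | s(o, y) ∈ ω}) := by
    rcases ht with hvt | hyt
    · -- parallel to `e`
      have hne : s(a₂, t) ≠ s(o, v) := by
        intro h'; rcases Sym2.eq_iff.1 h' with ⟨h1, -⟩ | ⟨h1, -⟩
        · exact hao (h1 ▸ ha₂)
        · exact hav (h1 ▸ ha₂)
      have hnf : s(a₂, t) ≠ s(o, y) := by
        intro h'; rcases Sym2.eq_iff.1 h' with ⟨h1, -⟩ | ⟨h1, -⟩
        · exact hao (h1 ▸ ha₂)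
        · exact hay (h1 ▸ ha₂)
      exact adjForestNoSq_bad_eq_good_of_parallel hd' heN hgN hne hnf hov' ha₂t hvy ho₂
        (hvt.mono (openGraph_mono (subset_insert _ _)))
    · -- parallel to `f`: the F6 identity at `(o; y, v)`, transported by `and_comm` and the swap
      have hne : s(a₂, t) ≠ s(o, y) := by
        intro h'; rcases Sym2.eq_iff.1 h' with ⟨h1, -⟩ | ⟨h1, -⟩
        · exact hao (h1 ▸ ha₂)
        · exact hay (h1 ▸ ha₂)
      have hnf : s(a₂, t) ≠ s(o, v) := by
        intro h'; rcases Sym2.eq_iff.1 h' with ⟨h1, -⟩ | ⟨h1, -⟩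
        · exact hao (h1 ▸ ha₂)
        · exact hav (h1 ▸ ha₂)
      have key := adjForestNoSq_bad_eq_good_of_parallel (v := y) (y := v) hd' hfN hgN hne hnf hoy' ha₂t hvy.symm ho₂
        (hyt.mono (openGraph_mono (subset_insert _ _)))
      have hEF : {ω : BondConfig V | s(o, y) ∈ ω ∧ s(o, v) ∈ ω} = {ω | s(o, v) ∈ ω ∧ s(o, y) ∈ ω} := by
        ext ω; simp only [mem_setOf_eq]; exact and_comm
      rw [hEF, fibreCount_swap N _ (forestEv V ∩ {ω | s(o, y) ∈ ω})] at key
      exact key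
  rw [hb, hg, hpin] at hnode
  omega

end Steps

/-! ### Form conversions and small reductions -/

section Forms

variable {N u : BondConfig V} {o v y a : V}

omit [Fintype V] in
/-- `{ω | o ~ a}` is `reachEv o a`. [folklore] -/
theorem setOf_reachable_eq_reachEv (o a : V) : ({ω | (openGraph ω).Reachable o a} : Set (BondConfig V)) = reachEv o a := rfl

omit [Fintype V] in
/-- `{ω | ¬ o ~ a}` is `(reachEv o a)ᶜ`. [folklore] -/
theorem setOf_not_reachable_eq_compl (o a : V) : ({ω | ¬ (openGraph ω).Reachable o a} : Set (BondConfig V)) = (reachEv o a)ᶜ := rfl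

/-- (★) is symmetric in `v, y`. [cite: Linusson2011, Prop. 2.6] -/
theorem hubPairOneClass_symm
    (h : fibreCount N u (forestEv V ∩ {ω | s(o, y) ∈ ω ∧ s(o, v) ∈ ω} ∩ reachEv o a) (forestEv V ∩ (reachEv o a)ᶜ) +
        fibreCount N u (forestEv V ∩ reachEv o a) (forestEv V ∩ {ω | s(o, y) ∈ ω ∧ s(o, v) ∈ ω} ∩ (reachEv o a)ᶜ) ≤
      fibreCount N u (forestEv V ∩ {ω | s(o, y) ∈ ω} ∩ reachEv o a) (forestEv V ∩ {ω | s(o, v) ∈ ω} ∩ (reachEv o a)ᶜ) +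
        fibreCount N u (forestEv V ∩ {ω | s(o, v) ∈ ω} ∩ reachEv o a) (forestEv V ∩ {ω | s(o, y) ∈ ω} ∩ (reachEv o a)ᶜ)) :
    fibreCount N u (forestEv V ∩ {ω | s(o, v) ∈ ω ∧ s(o, y) ∈ ω} ∩ reachEv o a) (forestEv V ∩ (reachEv o a)ᶜ) +
        fibreCount N u (forestEv V ∩ reachEv o a) (forestEv V ∩ {ω | s(o, v) ∈ ω ∧ s(o, y) ∈ ω} ∩ (reachEv o a)ᶜ) ≤
      fibreCount N u (forestEv V ∩ {ω | s(o, v) ∈ ω} ∩ reachEv o a) (forestEv V ∩ {ω | s(o, y) ∈ ω} ∩ (reachEv o a)ᶜ) +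
        fibreCount N u (forestEv V ∩ {ω | s(o, y) ∈ ω} ∩ reachEv o a) (forestEv V ∩ {ω | s(o, v) ∈ ω} ∩ (reachEv o a)ᶜ) := by
  have hEF : {ω : BondConfig V | s(o, y) ∈ ω ∧ s(o, v) ∈ ω} = {ω | s(o, v) ∈ ω ∧ s(o, y) ∈ ω} := by
    ext ω; simp only [mem_setOf_eq]; exact and_comm
  rw [hEF] at h
  omega

/-- **(★) with equality at a type vertex PINNED TO `v`** (transport of F3 `hubPairOneClass_at_v`, with its degenerate cases).
[cite: SempleWelsh2008, Conj. 1.1 (p. 2)] [cite: Linusson2011, Prop. 2.6] -/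
theorem hubPairOneClass_le_of_pinned_to_v (hd : Disjoint u N) (hvy : v ≠ y) (hav : (openGraph u).Reachable a v) :
    fibreCount N u (forestEv V ∩ {ω | s(o, v) ∈ ω ∧ s(o, y) ∈ ω} ∩ reachEv o a) (forestEv V ∩ (reachEv o a)ᶜ) +
        fibreCount N u (forestEv V ∩ reachEv o a) (forestEv V ∩ {ω | s(o, v) ∈ ω ∧ s(o, y) ∈ ω} ∩ (reachEv o a)ᶜ) ≤
      fibreCount N u (forestEv V ∩ {ω | s(o, v) ∈ ω} ∩ reachEv o a) (forestEv V ∩ {ω | s(o, y) ∈ ω} ∩ (reachEv o a)ᶜ) +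
        fibreCount N u (forestEv V ∩ {ω | s(o, y) ∈ ω} ∩ reachEv o a) (forestEv V ∩ {ω | s(o, v) ∈ ω} ∩ (reachEv o a)ᶜ) := by
  by_cases hov : o = v
  · subst hov
    rw [fibreCount_eq_zero_of_forall _ _ _ _ fun ω _ hA _ => hA.1.1.1 _ hA.1.2.1 (Sym2.mk_isDiag_iff.2 rfl),
      fibreCount_eq_zero_of_forall _ _ _ _ fun ω _ _ hB => hB.1.1.1 _ hB.1.2.1 (Sym2.mk_isDiag_iff.2 rfl)]
    exact Nat.zero_le _
  have htr : ∀ (P Q : Set (BondConfig V)), fibreCount N u (P ∩ reachEv o a) (Q ∩ (reachEv o a)ᶜ) =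
      fibreCount N u (P ∩ {ω | (openGraph ω).Reachable o v}) (Q ∩ {ζ | ¬ (openGraph ζ).Reachable o v}) := fun P Q =>
    typeA_count_congr_of_pinned hd hav P Q
  by_cases heN : s(o, v) ∈ N
  · rw [htr, htr, htr, htr]
    exact (hubPairOneClass_at_v hd hov hvy heN).le
  · by_cases heu : s(o, v) ∈ u
    · have hz : ∀ (P Q : Set (BondConfig V)), fibreCount N u (P ∩ reachEv o a) (Q ∩ (reachEv o a)ᶜ) = 0 := by
        intro P Q
        refine fibreCount_eq_zero_of_forall _ _ _ _ fun ω hω _ hB => hB.2 ?_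
        obtain ⟨-, h2⟩ := pinned_subset_and_partner hd hω
        exact ((openGraph_adj _ o v).2 ⟨h2 heu, hov⟩).reachable.trans (hav.mono (openGraph_mono h2)).symm
      rw [hz, hz]; exact Nat.zero_le _
    · rw [fibreCount_eq_zero_of_forall _ _ _ _ fun ω hω hA _ => (notMem_and_notMem_symmDiff_of_fibre heN heu hω).1 hA.1.2.1,
        fibreCount_eq_zero_of_forall _ _ _ _ fun ω hω _ hB => (notMem_and_notMem_symmDiff_of_fibre heN heu hω).2 hB.1.2.1]
      exact Nat.zero_le _

/-- **No free pair at the pinned class of `a` ⇒ the type-A counts vanish** (the last free pair would touch `[a]`).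
[cite: Grimmett2006, §1.5 (p. 13)] [cite: Linusson2011, Prop. 2.6] -/
theorem typeA_count_eq_zero_of_no_pair (hd : Disjoint u N) (hnone : ∀ q ∈ N, ∀ z ∈ q, ¬ (openGraph u).Reachable a z)
    (P Q : Set (BondConfig V)) :
    fibreCount N u (forestEv V ∩ P ∩ reachEv o a) (forestEv V ∩ Q ∩ (reachEv o a)ᶜ) = 0 := by
  refine fibreCount_eq_zero_of_forall _ _ _ _ fun ω hω hA hB => ?_
  obtain ⟨hsub, hsub'⟩ := pinned_subset_and_partner hd hω
  have hnot : ¬ (openGraph u).Reachable o a := fun h' => hB.2 (h'.mono (openGraph_mono hsub'))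
  obtain ⟨x, a', hxω, hxN, haa', -, -⟩ :=
    exists_last_free_pair (M := N) (u₀ := u) (a := a) _ ω o rfl hsub (subset_union_of_fibre hω).1 hA.1.1 hA.2 hnot
  exact hnone _ hxN a' (Sym2.mem_mk_right _ _) haa'

end Forms

/-! ### The descent -/

section Descent

/-- **THE DESCENT.**  Assume AAM and the node for all fibres with fewer than `k` free pairs.  Then (★) holds at `(o, a)` on every fibre
`(N, u)` with `|N| + 2 ≤ k`, `e, f ∈ N`, and `[a], [o], [v], [y]` pairwise distinct classes (`[v] ≠ [y]` not needed).
[cite: SempleWelsh2008, Conj. 1.1 (p. 2); Thm. 4.2 (p. 11)] [cite: Linusson2011, Prop. 2.6] -/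
theorem hubPairOneClass_descent (hA : HubPairAbsorptionMonoOn V) {k : ℕ}
    (IH : ∀ (M u₀ : BondConfig V), M.ncard < k → Disjoint u₀ M → ∀ (o v y : V), v ≠ y →
      fibreCount M u₀ (forestEv V ∩ {ω | s(o, v) ∈ ω ∧ s(o, y) ∈ ω}) (forestEv V) ≤
        fibreCount M u₀ (forestEv V ∩ {ω | s(o, v) ∈ ω}) (forestEv V ∩ {ω | s(o, y) ∈ ω})) :
    ∀ (m : ℕ) (N u : BondConfig V), N.ncard = m → m + 2 ≤ k → Disjoint u N → ∀ (o v y a : V), v ≠ y →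
      s(o, v) ∈ N → s(o, y) ∈ N → ¬ (openGraph u).Reachable a o → ¬ (openGraph u).Reachable a v → ¬ (openGraph u).Reachable a y →
      ¬ (openGraph u).Reachable o v → ¬ (openGraph u).Reachable o y →
      fibreCount N u (forestEv V ∩ {ω | s(o, v) ∈ ω ∧ s(o, y) ∈ ω} ∩ reachEv o a) (forestEv V ∩ (reachEv o a)ᶜ) +
          fibreCount N u (forestEv V ∩ reachEv o a) (forestEv V ∩ {ω | s(o, v) ∈ ω ∧ s(o, y) ∈ ω} ∩ (reachEv o a)ᶜ) ≤
        fibreCount N u (forestEv V ∩ {ω | s(o, v) ∈ ω} ∩ reachEv o a) (forestEv V ∩ {ω | s(o, y) ∈ ω} ∩ (reachEv o a)ᶜ) +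
          fibreCount N u (forestEv V ∩ {ω | s(o, y) ∈ ω} ∩ reachEv o a) (forestEv V ∩ {ω | s(o, v) ∈ ω} ∩ (reachEv o a)ᶜ) := by
  intro m
  induction m using Nat.strong_induction_on with
  | _ m ih =>
    intro N u hm hmk hd o v y a hvy heN hfN hao hav hay hov hoy
    have R := fun (z : V) => SimpleGraph.Reachable.refl (G := openGraph u) z
    -- (α) a free pair between `[o]` and `[a]`: F2 and the node of the pinned fibre
    by_cases hα : ∃ o₁ a₁, s(o₁, a₁) ∈ N ∧ (openGraph u).Reachable o o₁ ∧ (openGraph u).Reachable a a₁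
    · obtain ⟨o₁, a₁, hqN, ho₁, ha₁⟩ := hα
      have hoa₁ : o₁ ≠ a₁ := fun h' => hao ((ha₁.trans (h' ▸ ho₁).symm))
      have hqe : s(o₁, a₁) ≠ s(o, v) := by
        intro h'; rcases Sym2.eq_iff.1 h' with ⟨-, h2⟩ | ⟨-, h2⟩
        · exact hav (h2 ▸ ha₁)
        · exact hao (h2 ▸ ha₁)
      have hqf : s(o₁, a₁) ≠ s(o, y) := by
        intro h'; rcases Sym2.eq_iff.1 h' with ⟨-, h2⟩ | ⟨-, h2⟩
        · exact hay (h2 ▸ ha₁)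
        · exact hao (h2 ▸ ha₁)
      obtain ⟨c1, c2, c3, c4⟩ := hubPair_counts_eq_pinned_of_adjacent (g := s(o₁, a₁)) (v := v) (y := y) hd hqN rfl hoa₁ ho₁ ha₁ hqe hqf
      simp only [setOf_reachable_eq_reachEv, setOf_not_reachable_eq_compl] at c1 c2 c3 c4
      rw [c1, c2, c3, c4, fibreCount_swap _ _ (forestEv V) (forestEv V ∩ {ω | s(o, v) ∈ ω ∧ s(o, y) ∈ ω}),
        fibreCount_swap _ _ (forestEv V ∩ {ω | s(o, y) ∈ ω}) (forestEv V ∩ {ω | s(o, v) ∈ ω})]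
      have hlt : (N \ {s(o₁, a₁)}).ncard < k := by
        have := Set.ncard_sdiff_singleton_add_one hqN (Set.toFinite N); omega
      have key := IH (N \ {s(o₁, a₁)}) (insert s(o₁, a₁) u) hlt
        (Set.disjoint_insert_left.2 ⟨fun h => h.2 rfl, hd.mono_right sdiff_subset⟩) o v y hvy
      omega
    -- (β) a free pair from `[a]` to a fresh class: one absorption, then the descent one level down
    by_cases hβ : ∃ a₁ x, s(a₁, x) ∈ N ∧ (openGraph u).Reachable a a₁ ∧ ¬ (openGraph u).Reachable a x ∧
        ¬ (openGraph u).Reachable o x ∧ ¬ (openGraph u).Reachable v x ∧ ¬ (openGraph u).Reachable y x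
    · obtain ⟨a₁, x, hqN, ha₁, hax, hox, hvx, hyx⟩ := hβ
      have hxo : x ≠ o := fun h => hox (h ▸ R x)
      have hxv : x ≠ v := fun h => hvx (h ▸ R x)
      have hxy : x ≠ y := fun h => hyx (h ▸ R x)
      have hqe : s(a₁, x) ≠ s(o, v) := by
        intro h'; rcases Sym2.eq_iff.1 h' with ⟨h1, -⟩ | ⟨h1, -⟩
        · exact hao (h1 ▸ ha₁)
        · exact hav (h1 ▸ ha₁)
      have hqf : s(a₁, x) ≠ s(o, y) := by
        intro h'; rcases Sym2.eq_iff.1 h' with ⟨h1, -⟩ | ⟨h1, -⟩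
        · exact hao (h1 ▸ ha₁)
        · exact hay (h1 ▸ ha₁)
      have hm1 : (N \ {s(a₁, x)}).ncard = m - 1 := by
        have := Set.ncard_sdiff_singleton_add_one hqN (Set.toFinite N); omega
      have hm1' : (N \ {s(a₁, x)}).ncard < m := by
        have := Set.ncard_sdiff_singleton_add_one hqN (Set.toFinite N); omega
      have hd' : Disjoint (insert s(a₁, x) u) (N \ {s(a₁, x)}) :=
        Set.disjoint_insert_left.2 ⟨fun h => h.2 rfl, hd.mono_right sdiff_subset⟩
      -- the new class of `a₁` is `[a] ∪ [x]`: still away from `o, v, y`; `[o]`, `[v]`, `[y]` untouched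
      have far : ∀ s : V, ¬ (openGraph u).Reachable s a₁ → ¬ (openGraph u).Reachable s x → ∀ t, ¬ (openGraph u).Reachable s t →
          ¬ (openGraph (insert s(a₁, x) u)).Reachable s t := fun s h1 h2 t h3 h =>
        h3 (reachable_of_reachable_insert_pinned h h1 h2)
      have hoa₁ : ¬ (openGraph u).Reachable o a₁ := fun h => hao (ha₁.trans h.symm)
      have hva₁ : ¬ (openGraph u).Reachable v a₁ := fun h => hav (ha₁.trans h.symm)
      have hya₁ : ¬ (openGraph u).Reachable y a₁ := fun h => hay (ha₁.trans h.symm)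
      have hm_pos : 1 ≤ m := by have := Set.ncard_sdiff_singleton_add_one hqN (Set.toFinite N); omega
      have hrec := ih (m - 1) (by omega) (N \ {s(a₁, x)}) (insert s(a₁, x) u) hm1 (by omega) hd' o v y a₁ hvy
        ⟨heN, fun h => hqe (mem_singleton_iff.1 h).symm⟩ ⟨hfN, fun h => hqf (mem_singleton_iff.1 h).symm⟩
        (fun h => far o hoa₁ hox a₁ hoa₁ h.symm) (fun h => far v hva₁ hvx a₁ hva₁ h.symm) (fun h => far y hya₁ hyx a₁ hya₁ h.symm)
        (far o hoa₁ hox v hov) (far o hoa₁ hox y hoy)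
      have step := hubPairOneClass_of_absorption_step hA hd hvy hqN ha₁ hxo hxv hxy hqe hqf
        (by simp only [setOf_reachable_eq_reachEv, setOf_not_reachable_eq_compl]; exact hrec)
      simp only [setOf_reachable_eq_reachEv, setOf_not_reachable_eq_compl] at step
      exact step
    -- (γ) no free pair at `[a]`
    by_cases hγ : ∀ q ∈ N, ∀ z ∈ q, ¬ (openGraph u).Reachable a z
    · have e1 : forestEv V ∩ (reachEv o a)ᶜ = forestEv V ∩ univ ∩ (reachEv o a)ᶜ := by rw [inter_univ]
      have e2 : forestEv V ∩ reachEv o a = forestEv V ∩ univ ∩ reachEv o a := by rw [inter_univ]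
      rw [e1, e2, typeA_count_eq_zero_of_no_pair hd hγ, typeA_count_eq_zero_of_no_pair hd hγ]
      exact Nat.zero_le _
    -- (δ) the remaining pairs at `[a]` go to `[v] ∪ [y]`: insert `s(o, a)` (F1 + F6 + node)
    push Not at hγ
    obtain ⟨q, hqN, z, hzq, haz⟩ := hγ
    set t := Sym2.Mem.other hzq with htdef
    have hq : s(z, t) = q := Sym2.other_spec hzq
    rw [← hq] at hqN
    by_cases hat : (openGraph u).Reachable a t
    · -- a quotient loop at `[a]`: the fibre is empty
      have h0 := fibreCount_forest_eq_zero_of_quotLoop hd hqN (haz.symm.trans hat)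
      have e1 : forestEv V ∩ {ω : BondConfig V | s(o, v) ∈ ω ∧ s(o, y) ∈ ω} ∩ reachEv o a =
          forestEv V ∩ ({ω : BondConfig V | s(o, v) ∈ ω ∧ s(o, y) ∈ ω} ∩ reachEv o a) := inter_assoc _ _ _
      have e2 : forestEv V ∩ {ω : BondConfig V | s(o, v) ∈ ω ∧ s(o, y) ∈ ω} ∩ (reachEv o a)ᶜ =
          forestEv V ∩ ({ω : BondConfig V | s(o, v) ∈ ω ∧ s(o, y) ∈ ω} ∩ (reachEv o a)ᶜ) := inter_assoc _ _ _
      rw [e1, e2, h0, h0]; exact Nat.zero_le _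
    have hot : ¬ (openGraph u).Reachable o t := fun h => hα ⟨t, z, Sym2.eq_swap ▸ hqN, h, haz⟩
    have hvyt : (openGraph u).Reachable v t ∨ (openGraph u).Reachable y t := by
      by_contra hn; push Not at hn
      exact hβ ⟨z, t, hqN, haz, hat, hot, hn.1, hn.2⟩
    have hoaN : s(o, a) ∉ N := fun h => hα ⟨o, a, h, R o, R a⟩
    have hoa : o ≠ a := fun h => hao (h ▸ R o)
    have hoau : s(o, a) ∉ u := fun h => hao ((openGraph_adj u a o).2 ⟨Sym2.eq_swap ▸ h, hoa.symm⟩).reachable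
    have hlt : (insert s(o, a) N).ncard < k := by rw [Set.ncard_insert_of_notMem hoaN (Set.toFinite N)]; omega
    exact hubPairOneClass_of_insert_node hd hvy heN hfN hao hav hay hov hoy hoaN hqN haz hvyt
      (IH (insert s(o, a) N) u hlt (Set.disjoint_insert_right.2 ⟨hoau, hd⟩) o v y hvy)

end Descent

end FK
end Summit.CriticalPhenomena.PercolationContinuityZ3.Theorems

end
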